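import Mathlib
import HarnessLib

/-!
# LINE (A) `product_plus_one` — log-convexity triples: the algebra behind «Λ ↑, Z strictly ↑» for incoherent clouds

Crux item stmt-ValiantsHypothesis-18050, LINE (A) floor structure (memo `pub/val-lit/lmr/NOTE-p7g15-18050-LINEA-incoherent-cell.md` §11–§12).
With `θ = x·d/dx`, a positive function `f` is log-convex in `log x` iff `(θf)² ≤ f·θ²f`.  This file is the POINTWISE ALGEBRA of that inequality for
value triples `(f0, f1, f2) = (f, θf, θ²f)`: closure under sums (`lc_add`, `lc_sum`), products (`lc_mul`, `lc_mul_strict`), two-term posynomials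
(`lc_posynomial2`), the inverse `u = 1/(a − h)` of an unswitched incoherent row (`lc_inv`: `θu = (θh)u²`, `θ²u = (θ²h)u² + 2(θh)²u³`) and its
Euler ratio `ψ = (θh)·u` (`lc_psi`), and the two CLOUD inequalities the one-riser theorem needs (§11 (2), series-free form):

* `cloud_theta_Lambda_pos` — `Λ = Pl + θPl/Pl − p` has `θΛ·Pl² = θPl·Pl² + (Pl·θ²Pl − (θPl)²) ≥ θPl·Pl² > 0` once `Pl = Σ mψ` is log-convex;
* `cloud_N_logConvex` — `N := Pl² + Σ_i m_i (A_i + ψ_i²)` (so that `Λ = N/Pl` and `Z = E(Λ) = Pl − p + θN/N`) satisfies `(θN)² ≤ N·θ²N` whenever every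
  `ψ_i` and every `A_i` does; hence `θZ = θPl + (Nθ²N − (θN)²)/N² ≥ θPl > 0`.

The calculus layer (the actual `θ`-derivatives of `ψ_i(x) = (p b_i x^p + q c_i x^q)/(a_i − b_i x^p − c_i x^q)` up to order three, and the assembly into
✓ `oneRiser_no_four_zeros_of_strictMonoZ`) is the next file.  Honest framing: elementary real inequalities; NOT `OneChangeFloorK3` / `stub_classRowK3` /
`stub_polyLaw` / `MatrixDescartes` / B; `VP ≠ VNP` NOT proved.  No definitions, no named facts; Mathlib only.
-/

set_option linter.dupNamespace false

namespace Summit.ValiantsHypothesis.ValiantsHypothesis.Theorems.LacunarySymmetroidMatrixDescartes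

namespace ProductPlusOne

open Finset
open scoped BigOperators

/-! ### §1 Closure of the log-convexity inequality `f1² ≤ f0·f2` -/

/-- Sum of two log-convex triples is log-convex. -/
theorem lc_add {f0 f1 f2 g0 g1 g2 : ℝ} (hf0 : 0 ≤ f0) (hf2 : 0 ≤ f2) (hf : f1 ^ 2 ≤ f0 * f2)
    (hg0 : 0 ≤ g0) (hg2 : 0 ≤ g2) (hg : g1 ^ 2 ≤ g0 * g2) :
    (f1 + g1) ^ 2 ≤ (f0 + g0) * (f2 + g2) := by
  -- `(f0 g2 + g0 f2)² ≥ 4 f0 f2 g0 g2 ≥ 4 f1² g1²`, so `f0 g2 + g0 f2 ≥ 2 |f1 g1|`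
  have h1 : 4 * (f1 * g1) ^ 2 ≤ (f0 * g2 + g0 * f2) ^ 2 := by
    have hA : (f1 * g1) ^ 2 ≤ (f0 * f2) * (g0 * g2) := by
      rw [mul_pow]; exact mul_le_mul hf hg (sq_nonneg _) (mul_nonneg hf0 hf2)
    nlinarith [sq_nonneg (f0 * g2 - g0 * f2)]
  have h2 : 2 * |f1 * g1| ≤ f0 * g2 + g0 * f2 := by
    have hnn : 0 ≤ f0 * g2 + g0 * f2 := by positivity
    have hsq : (2 * |f1 * g1|) ^ 2 ≤ (f0 * g2 + g0 * f2) ^ 2 := by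
      rw [mul_pow, sq_abs]; linarith
    exact (pow_le_pow_iff_left₀ (by positivity) hnn two_ne_zero).1 hsq
  have h3 : f1 * g1 ≤ |f1 * g1| := le_abs_self _
  nlinarith

/-- Finite sums of log-convex triples are log-convex. -/
theorem lc_sum {ι : Type*} (s : Finset ι) (f0 f1 f2 : ι → ℝ) (h0 : ∀ i ∈ s, 0 ≤ f0 i) (h2 : ∀ i ∈ s, 0 ≤ f2 i)
    (h : ∀ i ∈ s, f1 i ^ 2 ≤ f0 i * f2 i) :
    (∑ i ∈ s, f1 i) ^ 2 ≤ (∑ i ∈ s, f0 i) * (∑ i ∈ s, f2 i) := by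
  classical
  induction s using Finset.induction_on with
  | empty => simp
  | insert a s ha ih =>
    rw [Finset.sum_insert ha, Finset.sum_insert ha, Finset.sum_insert ha]
    have h0' : ∀ i ∈ s, 0 ≤ f0 i := fun i hi => h0 i (Finset.mem_insert_of_mem hi)
    have h2' : ∀ i ∈ s, 0 ≤ f2 i := fun i hi => h2 i (Finset.mem_insert_of_mem hi)
    have h' : ∀ i ∈ s, f1 i ^ 2 ≤ f0 i * f2 i := fun i hi => h i (Finset.mem_insert_of_mem hi)
    exact lc_add (h0 a (Finset.mem_insert_self a s)) (h2 a (Finset.mem_insert_self a s))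
      (h a (Finset.mem_insert_self a s)) (Finset.sum_nonneg h0') (Finset.sum_nonneg h2') (ih h0' h2' h')

/-- Product of two log-convex triples: `(fg, θ(fg), θ²(fg)) = (f0 g0, f1 g0 + f0 g1, f2 g0 + 2 f1 g1 + f0 g2)`. -/
theorem lc_mul {f0 f1 f2 g0 g1 g2 : ℝ} (hf : f1 ^ 2 ≤ f0 * f2) (hg : g1 ^ 2 ≤ g0 * g2) :
    (f1 * g0 + f0 * g1) ^ 2 ≤ (f0 * g0) * (f2 * g0 + 2 * f1 * g1 + f0 * g2) := by
  nlinarith [mul_nonneg (sq_nonneg g0) (sub_nonneg.2 hf), mul_nonneg (sq_nonneg f0) (sub_nonneg.2 hg)]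

/-- Product, strict version: a STRICTLY log-convex positive triple times a log-convex triple with `g0 > 0` is strictly log-convex. -/
theorem lc_mul_strict {f0 f1 f2 g0 g1 g2 : ℝ} (hf : f1 ^ 2 < f0 * f2) (hg0 : 0 < g0) (hg : g1 ^ 2 ≤ g0 * g2) :
    (f1 * g0 + f0 * g1) ^ 2 < (f0 * g0) * (f2 * g0 + 2 * f1 * g1 + f0 * g2) := by
  nlinarith [mul_pos (pow_pos hg0 2) (sub_pos.2 hf), mul_nonneg (sq_nonneg f0) (sub_nonneg.2 hg)]

/-- A two-term posynomial `βX + γY` (`β, γ, X, Y ≥ 0`; `θX = pX`, `θY = qY`) is log-convex: triple `(βX + γY, pβX + qγY, p²βX + q²γY)`. -/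
theorem lc_posynomial2 (β γ X Y p q : ℝ) (hβ : 0 ≤ β) (hγ : 0 ≤ γ) (hX : 0 ≤ X) (hY : 0 ≤ Y) :
    (p * β * X + q * γ * Y) ^ 2 ≤ (β * X + γ * Y) * (p ^ 2 * β * X + q ^ 2 * γ * Y) := by
  have : (β * X + γ * Y) * (p ^ 2 * β * X + q ^ 2 * γ * Y) - (p * β * X + q * γ * Y) ^ 2
      = β * γ * X * Y * (p - q) ^ 2 := by ring
  nlinarith [mul_nonneg (mul_nonneg (mul_nonneg (mul_nonneg hβ hγ) hX) hY) (sq_nonneg (p - q))]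

/-- The inverse `u = 1/(a − h)` of an UNSWITCHED incoherent row (`u > 0`, `θ²h ≥ 0`): triple `(u, (θh)u², (θ²h)u² + 2(θh)²u³)` is log-convex,
with slack `u³(θ²h + (θh)²u)`. -/
theorem lc_inv (u H1 H2 : ℝ) (hu : 0 < u) (hH2 : 0 ≤ H2) :
    (H1 * u ^ 2) ^ 2 ≤ u * (H2 * u ^ 2 + 2 * H1 ^ 2 * u ^ 3) := by
  have : u * (H2 * u ^ 2 + 2 * H1 ^ 2 * u ^ 3) - (H1 * u ^ 2) ^ 2 = u ^ 3 * (H2 + H1 ^ 2 * u) := by ring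
  nlinarith [mul_nonneg (pow_pos hu 3).le (add_nonneg hH2 (mul_nonneg (sq_nonneg H1) hu.le))]

/-- Same, STRICT, when `θh ≠ 0` (a genuine puller). -/
theorem lc_inv_strict (u H1 H2 : ℝ) (hu : 0 < u) (hH2 : 0 ≤ H2) (hH1 : H1 ≠ 0) :
    (H1 * u ^ 2) ^ 2 < u * (H2 * u ^ 2 + 2 * H1 ^ 2 * u ^ 3) := by
  have : u * (H2 * u ^ 2 + 2 * H1 ^ 2 * u ^ 3) - (H1 * u ^ 2) ^ 2 = u ^ 3 * (H2 + H1 ^ 2 * u) := by ring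
  have hpos : 0 < H1 ^ 2 * u := mul_pos (by positivity) hu
  nlinarith [mul_pos (pow_pos hu 3) (lt_of_lt_of_le hpos (le_add_of_nonneg_left hH2))]

/-- The Euler ratio `ψ = (θh)·u` of an unswitched incoherent row: triple `(H1 u, H2 u + H1² u², H3 u + 3 H1 H2 u² + 2 H1³ u³)` is log-convex
when `(H1, H2, H3)` is (posynomial `θh`) and `H2 ≥ 0`, `u > 0`; slack `(H1H3 − H2²)u² + H1²H2 u³ + H1⁴u⁴`. -/
theorem lc_psi (u H1 H2 H3 : ℝ) (hu : 0 < u) (hH2 : 0 ≤ H2) (hH : H2 ^ 2 ≤ H1 * H3) :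
    (H2 * u + H1 ^ 2 * u ^ 2) ^ 2 ≤ (H1 * u) * (H3 * u + 3 * H1 * H2 * u ^ 2 + 2 * H1 ^ 3 * u ^ 3) := by
  have : (H1 * u) * (H3 * u + 3 * H1 * H2 * u ^ 2 + 2 * H1 ^ 3 * u ^ 3) - (H2 * u + H1 ^ 2 * u ^ 2) ^ 2
      = (H1 * H3 - H2 ^ 2) * u ^ 2 + H1 ^ 2 * H2 * u ^ 3 + H1 ^ 4 * u ^ 4 := by ring
  nlinarith [mul_nonneg (sub_nonneg.2 hH) (sq_nonneg u), mul_nonneg (mul_nonneg (sq_nonneg H1) hH2) (pow_pos hu 3).le,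
    mul_nonneg (pow_nonneg (sq_nonneg H1) 2) (pow_pos hu 4).le]

/-! ### §2 The two cloud inequalities -/

/-- **`θΛ > 0`.**  For `Λ = Pl + θPl/Pl − p`: `θΛ = θPl + (Pl·θ²Pl − (θPl)²)/Pl²`; if the pull triple `(Pl, θPl, θ²Pl)` is log-convex,
`Pl > 0` and `θPl > 0`, then `θΛ > 0`. -/
theorem cloud_theta_Lambda_pos {P0 P1 P2 : ℝ} (hP1 : 0 < P1) (hlc : P1 ^ 2 ≤ P0 * P2) :
    0 < P1 + (P0 * P2 - P1 ^ 2) / P0 ^ 2 := by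
  have : 0 ≤ (P0 * P2 - P1 ^ 2) / P0 ^ 2 := div_nonneg (sub_nonneg.2 hlc) (sq_nonneg _)
  linarith

/-- **`N = Pl² + Σ m (A + ψ²)` is log-convex** (value/θ/θ² triples throughout): given the pull triple `(P0, P1, P2) = Σ m (ψ0, ψ1, ψ2)` and,
for each row, log-convex triples `(ψ0, ψ1, ψ2)` (the Euler ratio) and `(A0, A1, A2)` (the `(θ²h − pθh)u` term) with non-negative entries
`ψ0, ψ2, A0, A2` and weights `m ≥ 0`, the triple
`(P0² + Σ m(A0 + ψ0²), 2P0P1 + Σ m(A1 + 2ψ0ψ1), 2P1² + 2P0P2 + Σ m(A2 + 2ψ1² + 2ψ0ψ2))` is log-convex. -/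
theorem cloud_N_logConvex {ι : Type*} (s : Finset ι) (m ψ0 ψ1 ψ2 A0 A1 A2 : ι → ℝ) (hm : ∀ i ∈ s, 0 ≤ m i)
    (hψ0 : ∀ i ∈ s, 0 ≤ ψ0 i) (hψ2 : ∀ i ∈ s, 0 ≤ ψ2 i) (hψ : ∀ i ∈ s, ψ1 i ^ 2 ≤ ψ0 i * ψ2 i)
    (hA0 : ∀ i ∈ s, 0 ≤ A0 i) (hA2 : ∀ i ∈ s, 0 ≤ A2 i) (hA : ∀ i ∈ s, A1 i ^ 2 ≤ A0 i * A2 i)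
    {P0 P1 P2 : ℝ} (hP : P1 ^ 2 ≤ P0 * P2) :
    (2 * P0 * P1 + ∑ i ∈ s, m i * (A1 i + 2 * ψ0 i * ψ1 i)) ^ 2
      ≤ (P0 ^ 2 + ∑ i ∈ s, m i * (A0 i + ψ0 i ^ 2))
        * (2 * P1 ^ 2 + 2 * P0 * P2 + ∑ i ∈ s, m i * (A2 i + 2 * ψ1 i ^ 2 + 2 * ψ0 i * ψ2 i)) := by
  -- the square `Pl²`: triple `(P0², 2P0P1, 2P1² + 2P0P2)` by `lc_mul`
  have hsq : (2 * P0 * P1) ^ 2 ≤ P0 ^ 2 * (2 * P1 ^ 2 + 2 * P0 * P2) := by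
    have h := lc_mul hP hP
    have e1 : P1 * P0 + P0 * P1 = 2 * P0 * P1 := by ring
    have e2 : P0 * P0 = P0 ^ 2 := by ring
    have e3 : P2 * P0 + 2 * P1 * P1 + P0 * P2 = 2 * P1 ^ 2 + 2 * P0 * P2 := by ring
    rw [e1, e2, e3] at h; exact h
  -- each row: `m·(A + ψ²)` is log-convex with non-negative ends
  have hrow0 : ∀ i ∈ s, 0 ≤ m i * (A0 i + ψ0 i ^ 2) := fun i hi => mul_nonneg (hm i hi) (by nlinarith [hA0 i hi])
  have hrow2 : ∀ i ∈ s, 0 ≤ m i * (A2 i + 2 * ψ1 i ^ 2 + 2 * ψ0 i * ψ2 i) := fun i hi =>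
    mul_nonneg (hm i hi) (by nlinarith [hA2 i hi, mul_nonneg (hψ0 i hi) (hψ2 i hi), sq_nonneg (ψ1 i)])
  have hrow : ∀ i ∈ s, (m i * (A1 i + 2 * ψ0 i * ψ1 i)) ^ 2
      ≤ (m i * (A0 i + ψ0 i ^ 2)) * (m i * (A2 i + 2 * ψ1 i ^ 2 + 2 * ψ0 i * ψ2 i)) := by
    intro i hi
    have hψsq : (2 * ψ0 i * ψ1 i) ^ 2 ≤ ψ0 i ^ 2 * (2 * ψ1 i ^ 2 + 2 * ψ0 i * ψ2 i) := by
      have h := lc_mul (hψ i hi) (hψ i hi)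
      have e1 : ψ1 i * ψ0 i + ψ0 i * ψ1 i = 2 * ψ0 i * ψ1 i := by ring
      have e2 : ψ0 i * ψ0 i = ψ0 i ^ 2 := by ring
      have e3 : ψ2 i * ψ0 i + 2 * ψ1 i * ψ1 i + ψ0 i * ψ2 i = 2 * ψ1 i ^ 2 + 2 * ψ0 i * ψ2 i := by ring
      rw [e1, e2, e3] at h; exact h
    have hsum := lc_add (hA0 i hi) (hA2 i hi) (hA i hi) (sq_nonneg (ψ0 i))
      (by nlinarith [mul_nonneg (hψ0 i hi) (hψ2 i hi), sq_nonneg (ψ1 i)]) hψsq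
    have hsum' : (A1 i + 2 * ψ0 i * ψ1 i) ^ 2 ≤ (A0 i + ψ0 i ^ 2) * (A2 i + 2 * ψ1 i ^ 2 + 2 * ψ0 i * ψ2 i) := by
      simpa only [add_assoc] using hsum
    have hm2 : 0 ≤ m i ^ 2 := sq_nonneg _
    calc (m i * (A1 i + 2 * ψ0 i * ψ1 i)) ^ 2 = m i ^ 2 * (A1 i + 2 * ψ0 i * ψ1 i) ^ 2 := by ring
      _ ≤ m i ^ 2 * ((A0 i + ψ0 i ^ 2) * (A2 i + 2 * ψ1 i ^ 2 + 2 * ψ0 i * ψ2 i)) :=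
          mul_le_mul_of_nonneg_left hsum' hm2
      _ = (m i * (A0 i + ψ0 i ^ 2)) * (m i * (A2 i + 2 * ψ1 i ^ 2 + 2 * ψ0 i * ψ2 i)) := by ring
  have hS := lc_sum s (fun i => m i * (A0 i + ψ0 i ^ 2)) (fun i => m i * (A1 i + 2 * ψ0 i * ψ1 i))
    (fun i => m i * (A2 i + 2 * ψ1 i ^ 2 + 2 * ψ0 i * ψ2 i)) hrow0 hrow2 hrow
  exact lc_add (sq_nonneg P0) (by nlinarith [sq_nonneg P1]) hsq
    (Finset.sum_nonneg hrow0) (Finset.sum_nonneg hrow2) hS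

/-- **`θZ > 0`** in the form the calculus layer uses: `θZ = θPl + (N·θ²N − (θN)²)/N²` with `θPl > 0` and `N` log-convex. -/
theorem cloud_theta_Z_pos {P1 N0 N1 N2 : ℝ} (hP1 : 0 < P1) (hlc : N1 ^ 2 ≤ N0 * N2) :
    0 < P1 + (N0 * N2 - N1 ^ 2) / N0 ^ 2 := by
  have : 0 ≤ (N0 * N2 - N1 ^ 2) / N0 ^ 2 := div_nonneg (sub_nonneg.2 hlc) (sq_nonneg _)
  linarith

end ProductPlusOne

end Summit.ValiantsHypothesis.ValiantsHypothesis.Theorems.LacunarySymmetroidMatrixDescartes
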